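import Literature.NumberTheory.ZetaValues.AperyLikeGeneratingFunctions
import HarnessLib

/-!
# The Apéry-like formula for `ζ(7)` (proof of the named fact `zeta_seven_apery_like`)

Topic `Literature/NumberTheory/ZetaValues`; proofs-only companion of `AperyLikeGeneratingFunctions.lean`, discharging
`zeta_seven_apery_like`: `ζ(7) = (5/2) Σ_{k≥1} (−1)^{k+1}/(k⁷ C(2k,k)) + (25/2) Σ_{k≥1} ((−1)^{k+1}/(k³ C(2k,k))) Σ_{j<k} j⁻⁴`
[Borwein–Bailey–Girgensohn 2004, (3.19); Rivoal 2004, p. 504] — the coefficient of `b⁴` in the Borwein–Bradley /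
Almkvist–Granville generating function `Σ_n n/(n⁴ − b⁴) = (5/2) Σ_k ((−1)^{k+1}/C(2k,k)) k/(k⁴−b⁴) ∏_{m<k}(m⁴+4b⁴)/(m⁴−b⁴)`.

Proof (Markov–WZ, after Kh. & T. Hessami Pilehrood, *Simultaneous generation for zeta values by the Markov–WZ
method*, DMTCS **10**:3 (2008) 115–123 = arXiv:0801.3310, Thm 1 / §2 with their `B₀ = 1`, `A₀ = C₀ = 0`, `x = 0`):
in `u = b⁴` the pair `F(n,k) = κ_n (2n+1)(n+2k+2) H(n,k)`, `G(n,k) = κ_n (5(n+1)²/2 + 3(n+1)k + k²) H(n,k)`,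
`H(n,k) = 1/∏_{m=k+1}^{n+k+1}(m⁴ − u)`, `κ_n = (−1)ⁿ n! ∏_{m≤n}(m⁴ + 4u)/(2^{n+1} ∏_{m≤n}(2m+1))` satisfies
`F(n+1,k) − F(n,k) = G(n,k+1) − G(n,k)` and `Σ_k F(0,k) = Σ_k (k+1)/((k+1)⁴ − u)`. As for `ζ(5)` (`KoecherZetaFiveProofs`)
the summation argument is run on the `u¹`-COEFFICIENTS: with `c(n,k) = κ_n H(n,k)|_{u=0} = (−1)ⁿ n!⁶ k!⁴/(2(2n+1)!((n+k+1)!)⁴)`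
the `u¹`-pair is `F₁ = F₀·W`, `G₁ = G₀·W`, `W(n,k) = 4Σ_{m≤n} m⁻⁴ + Σ_{m=k+1}^{n+k+1} m⁻⁴`; its WZ relation is a rational
identity (`ag_wz`), `F₁(0,k) = (k+1)⁻⁷`, `G₁(n,0) = (5/2)(−1)ⁿ/((n+1)⁷C(2n+2,n+1)) + (25/2)(−1)ⁿ(Σ_{m≤n} m⁻⁴)/((n+1)³C(2n+2,n+1))`,
and the boundary terms vanish by `(n+1)!(k+1)! ≤ (n+k+1)!`, `n!² ≤ (2n)!`, `W ≤ 10`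
(`|F₁(n,k)| ≤ 10/((n+1)³(k+1)²)`, `|G₁(n,k)| ≤ 25/((n+1)²(k+1)²)`).
All helpers are private theorems (no definitions); the only public declaration is `zeta_seven_apery_like_holds`.
-/

open Finset Filter Topology
noncomputable section

namespace Literature.NumberTheory.ZetaValues

/-- **WZ summation** with vanishing boundary terms (as in `KoecherZetaFiveProofs.lean`; private lemmas do not
cross files): if `F(n+1,k) − F(n,k) = G(n,k+1) − G(n,k)`, each `F(n,·)` is summable, `G(n,k) → 0` (`k → ∞`),
`Σ_k F(n,k) → 0` (`n → ∞`) and `G(·,0)` is summable, then `Σ_k F(0,k) = Σ_n G(n,0)`. [folklore] -/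
private theorem wz_tsum_eq' {F G : ℕ → ℕ → ℝ} (hWZ : ∀ n k, F (n + 1) k - F n k = G n (k + 1) - G n k)
    (hF : ∀ n, Summable (F n)) (hG : ∀ n, Tendsto (G n) atTop (𝓝 0))
    (hlim : Tendsto (fun n => ∑' k, F n k) atTop (𝓝 0)) (hG0 : Summable fun n => G n 0) :
    ∑' k, F 0 k = ∑' n, G n 0 := by
  have hstep : ∀ n, ∑' k, F (n + 1) k - ∑' k, F n k = -G n 0 := by
    intro n
    have h1 : Tendsto (fun K => ∑ k ∈ range K, (F (n + 1) k - F n k)) atTop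
        (𝓝 (∑' k, F (n + 1) k - ∑' k, F n k)) := by
      simp only [sum_sub_distrib]
      exact (hF (n + 1)).hasSum.tendsto_sum_nat.sub (hF n).hasSum.tendsto_sum_nat
    have h2 : Tendsto (fun K => ∑ k ∈ range K, (F (n + 1) k - F n k)) atTop (𝓝 (0 - G n 0)) := by
      have e : ∀ K, ∑ k ∈ range K, (F (n + 1) k - F n k) = G n K - G n 0 := fun K => by
        rw [sum_congr rfl fun k _ => hWZ n k]; exact sum_range_sub (G n) K
      simp only [e]
      exact (hG n).sub tendsto_const_nhds
    rw [tendsto_nhds_unique h1 h2, zero_sub]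
  have hsum : ∀ N, ∑' k, F N k - ∑' k, F 0 k = -∑ n ∈ range N, G n 0 := fun N => by
    rw [← sum_range_sub (fun n => ∑' k, F n k) N, sum_congr rfl fun n _ => hstep n, sum_neg_distrib]
  have h3 : Tendsto (fun N => ∑' k, F N k - ∑' k, F 0 k) atTop (𝓝 (0 - ∑' k, F 0 k)) :=
    hlim.sub tendsto_const_nhds
  simp only [hsum] at h3
  have h4 : Tendsto (fun N => -∑ n ∈ range N, G n 0) atTop (𝓝 (-∑' n, G n 0)) :=
    hG0.hasSum.tendsto_sum_nat.neg
  linarith [tendsto_nhds_unique h3 h4]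

/-- `c(n+1,k) = c(n,k) · (n+1)⁶/((2n+2)(2n+3)(n+k+2)⁴)` for `c(n,k) = n!⁶ k!⁴/(2(2n+1)!(n+k+1)!⁴)`. [folklore] -/
private theorem hyp7_succ_n (n k : ℕ) :
    (((n + 1).factorial : ℝ) ^ 6 * (k.factorial : ℝ) ^ 4 /
        (2 * ((2 * (n + 1) + 1).factorial : ℝ) * ((n + 1 + k + 1).factorial : ℝ) ^ 4)) =
      ((n.factorial : ℝ) ^ 6 * (k.factorial : ℝ) ^ 4 /
          (2 * ((2 * n + 1).factorial : ℝ) * ((n + k + 1).factorial : ℝ) ^ 4)) *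
        (((n : ℝ) + 1) ^ 6 / ((2 * (n : ℝ) + 2) * (2 * (n : ℝ) + 3) * ((n : ℝ) + k + 2) ^ 4)) := by
  have e1 : ((2 * (n + 1) + 1).factorial : ℝ) = (2 * (n : ℝ) + 3) * (2 * (n : ℝ) + 2) *
      ((2 * n + 1).factorial : ℝ) := by
    rw [show 2 * (n + 1) + 1 = (2 * n + 1) + 1 + 1 by ring, Nat.factorial_succ, Nat.factorial_succ]; push_cast; ring
  have e2 : ((n + 1).factorial : ℝ) = ((n : ℝ) + 1) * (n.factorial : ℝ) := by rw [Nat.factorial_succ]; push_cast; ring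
  have e3 : ((n + 1 + k + 1).factorial : ℝ) = ((n : ℝ) + k + 2) * ((n + k + 1).factorial : ℝ) := by
    rw [show n + 1 + k + 1 = (n + k + 1) + 1 by ring, Nat.factorial_succ]; push_cast; ring
  have h1 : ((2 * n + 1).factorial : ℝ) ≠ 0 := by positivity
  have h2 : ((n + k + 1).factorial : ℝ) ≠ 0 := by positivity
  rw [e1, e2, e3]
  field_simp

/-- `c(n,k+1) = c(n,k) · (k+1)⁴/(n+k+2)⁴`. [folklore] -/
private theorem hyp7_succ_k (n k : ℕ) :
    ((n.factorial : ℝ) ^ 6 * ((k + 1).factorial : ℝ) ^ 4 /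
        (2 * ((2 * n + 1).factorial : ℝ) * ((n + (k + 1) + 1).factorial : ℝ) ^ 4)) =
      ((n.factorial : ℝ) ^ 6 * (k.factorial : ℝ) ^ 4 /
          (2 * ((2 * n + 1).factorial : ℝ) * ((n + k + 1).factorial : ℝ) ^ 4)) *
        (((k : ℝ) + 1) ^ 4 / ((n : ℝ) + k + 2) ^ 4) := by
  have e2 : ((k + 1).factorial : ℝ) = ((k : ℝ) + 1) * (k.factorial : ℝ) := by rw [Nat.factorial_succ]; push_cast; ring
  have e3 : ((n + (k + 1) + 1).factorial : ℝ) = ((n : ℝ) + k + 2) * ((n + k + 1).factorial : ℝ) := by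
    rw [show n + (k + 1) + 1 = (n + k + 1) + 1 by ring, Nat.factorial_succ]; push_cast; ring
  have h1 : ((2 * n + 1).factorial : ℝ) ≠ 0 := by positivity
  have h2 : ((n + k + 1).factorial : ℝ) ≠ 0 := by positivity
  rw [e2, e3]
  field_simp

/-- **The `b⁴`-coefficient Markov–WZ pair**: `F₁(n+1,k) − F₁(n,k) = G₁(n,k+1) − G₁(n,k)`. [folklore] -/
private theorem ag_wz (n k : ℕ) :
    let F : ℕ → ℕ → ℝ := fun n k =>
      (-1 : ℝ) ^ n * ((n.factorial : ℝ) ^ 6 * (k.factorial : ℝ) ^ 4 /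
          (2 * ((2 * n + 1).factorial : ℝ) * ((n + k + 1).factorial : ℝ) ^ 4)) *
        ((2 * (n : ℝ) + 1) * ((n : ℝ) + 2 * k + 2)) *
        (4 * ∑ m ∈ range n, 1 / ((m : ℝ) + 1) ^ 4 + ∑ i ∈ range (n + 1), 1 / ((i : ℝ) + k + 1) ^ 4)
    let G : ℕ → ℕ → ℝ := fun n k =>
      (-1 : ℝ) ^ n * ((n.factorial : ℝ) ^ 6 * (k.factorial : ℝ) ^ 4 /
          (2 * ((2 * n + 1).factorial : ℝ) * ((n + k + 1).factorial : ℝ) ^ 4)) *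
        (5 * ((n : ℝ) + 1) ^ 2 / 2 + 3 * ((n : ℝ) + 1) * k + (k : ℝ) ^ 2) *
        (4 * ∑ m ∈ range n, 1 / ((m : ℝ) + 1) ^ 4 + ∑ i ∈ range (n + 1), 1 / ((i : ℝ) + k + 1) ^ 4)
    F (n + 1) k - F n k = G n (k + 1) - G n k := by
  intro F G
  simp only [F, G]
  rw [hyp7_succ_n, hyp7_succ_k]
  -- the harmonic-type sums under the two shifts
  have eU : ∑ m ∈ range (n + 1), 1 / ((m : ℝ) + 1) ^ 4 = ∑ m ∈ range n, 1 / ((m : ℝ) + 1) ^ 4 + 1 / ((n : ℝ) + 1) ^ 4 :=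
    sum_range_succ _ n
  have eT1 : ∑ i ∈ range (n + 1 + 1), 1 / ((i : ℝ) + k + 1) ^ 4 =
      ∑ i ∈ range (n + 1), 1 / ((i : ℝ) + k + 1) ^ 4 + 1 / ((n : ℝ) + 1 + k + 1) ^ 4 := by
    rw [sum_range_succ]; push_cast; ring
  have eT2 : ∑ i ∈ range (n + 1), 1 / ((i : ℝ) + ((k + 1 : ℕ) : ℝ) + 1) ^ 4 =
      ∑ i ∈ range (n + 1), 1 / ((i : ℝ) + k + 1) ^ 4 - 1 / ((k : ℝ) + 1) ^ 4 + 1 / ((n : ℝ) + 1 + k + 1) ^ 4 := by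
    have h := Finset.sum_range_succ' (fun i => 1 / ((i : ℝ) + k + 1) ^ 4) (n + 1)
    rw [sum_range_succ] at h
    have e : ∑ i ∈ range (n + 1), 1 / ((i : ℝ) + ((k + 1 : ℕ) : ℝ) + 1) ^ 4 =
        ∑ i ∈ range (n + 1), 1 / ((((i + 1 : ℕ)) : ℝ) + k + 1) ^ 4 :=
      sum_congr rfl fun i _ => by push_cast; ring
    rw [e]
    push_cast at h ⊢
    simp only [zero_add] at h
    linarith
  rw [eU, eT1, eT2, pow_succ]
  set C : ℝ := ((n.factorial : ℝ) ^ 6 * (k.factorial : ℝ) ^ 4 /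
    (2 * ((2 * n + 1).factorial : ℝ) * ((n + k + 1).factorial : ℝ) ^ 4)) with hC
  set s : ℝ := (-1 : ℝ) ^ n with hs
  set U : ℝ := ∑ m ∈ range n, 1 / ((m : ℝ) + 1) ^ 4 with hU
  set T : ℝ := ∑ i ∈ range (n + 1), 1 / ((i : ℝ) + k + 1) ^ 4 with hT
  push_cast
  have h1 : (n : ℝ) + k + 2 ≠ 0 := by positivity
  have h6 : (n : ℝ) + 1 + k + 1 ≠ 0 := by positivity
  field_simp
  ring

/-- `Σ_{m<n} 1/(m+1)² ≤ 2` (from `Σ_{m≤n} 1/(m+1)² ≤ 2 − 1/(n+1)`). [folklore] -/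
private theorem harm_two_le (n : ℕ) : ∑ m ∈ range n, 1 / ((m : ℝ) + 1) ^ 2 ≤ 2 := by
  have h : ∀ n : ℕ, ∑ m ∈ range (n + 1), 1 / ((m : ℝ) + 1) ^ 2 ≤ 2 - 1 / ((n : ℝ) + 1) := by
    intro n
    induction n with
    | zero => norm_num
    | succ n ih =>
      rw [sum_range_succ]
      push_cast
      have h1 : 1 / (((n : ℝ) + 1 + 1) ^ 2) ≤ 1 / ((n : ℝ) + 1) - 1 / ((n : ℝ) + 1 + 1) := by
        rw [div_sub_div _ _ (by positivity) (by positivity), div_le_div_iff₀ (by positivity) (by positivity)]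
        nlinarith [(n.cast_nonneg : (0 : ℝ) ≤ n)]
      linarith
  calc ∑ m ∈ range n, 1 / ((m : ℝ) + 1) ^ 2 ≤ ∑ m ∈ range (n + 1), 1 / ((m : ℝ) + 1) ^ 2 :=
        sum_le_sum_of_subset_of_nonneg (Finset.range_mono (Nat.le_succ n)) fun m _ _ => by positivity
    _ ≤ 2 := (h n).trans (by linarith [(by positivity : (0 : ℝ) < 1 / ((n : ℝ) + 1))])

/-- `0 ≤ W(n,k) = 4 Σ_{m≤n} m⁻⁴ + Σ_{m=k+1}^{n+k+1} m⁻⁴ ≤ 10`. [folklore] -/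
private theorem w_bounds (n k : ℕ) :
    0 ≤ (4 * ∑ m ∈ range n, 1 / ((m : ℝ) + 1) ^ 4 + ∑ i ∈ range (n + 1), 1 / ((i : ℝ) + k + 1) ^ 4) ∧
      (4 * ∑ m ∈ range n, 1 / ((m : ℝ) + 1) ^ 4 + ∑ i ∈ range (n + 1), 1 / ((i : ℝ) + k + 1) ^ 4) ≤ 10 := by
  have hU : ∑ m ∈ range n, 1 / ((m : ℝ) + 1) ^ 4 ≤ 2 :=
    (sum_le_sum fun m _ => by
      apply div_le_div_of_nonneg_left zero_le_one (by positivity)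
      have : (1 : ℝ) ≤ (m : ℝ) + 1 := by linarith [(m.cast_nonneg : (0 : ℝ) ≤ m)]
      exact pow_le_pow_right₀ this (by norm_num)).trans (harm_two_le n)
  have hT : ∑ i ∈ range (n + 1), 1 / ((i : ℝ) + k + 1) ^ 4 ≤ 2 :=
    (sum_le_sum fun i _ => by
      apply div_le_div_of_nonneg_left zero_le_one (by positivity)
      have h1 : (1 : ℝ) ≤ (i : ℝ) + 1 := by linarith [(i.cast_nonneg : (0 : ℝ) ≤ i)]
      have h2 : (i : ℝ) + 1 ≤ (i : ℝ) + k + 1 := by linarith [(k.cast_nonneg : (0 : ℝ) ≤ k)]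
      calc ((i : ℝ) + 1) ^ 2 ≤ ((i : ℝ) + k + 1) ^ 2 := by gcongr
        _ ≤ ((i : ℝ) + k + 1) ^ 4 := pow_le_pow_right₀ (h1.trans h2) (by norm_num)).trans (harm_two_le (n + 1))
  exact ⟨add_nonneg (mul_nonneg (by norm_num) (sum_nonneg fun m _ => by positivity))
    (sum_nonneg fun i _ => by positivity), by linarith⟩

/-- `(n+1)!(k+1)! ≤ (n+k+1)!`. [folklore] -/
private theorem factorial_succ_mul_factorial_succ_le (n k : ℕ) :
    (n + 1).factorial * (k + 1).factorial ≤ (n + k + 1).factorial := by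
  induction n with
  | zero => simp
  | succ n ih =>
    rw [Nat.factorial_succ (n + 1), show n + 1 + k + 1 = (n + k + 1) + 1 by ring, Nat.factorial_succ (n + k + 1),
      mul_assoc]
    exact Nat.mul_le_mul (by omega) ih

/-- The hypergeometric factor: `0 ≤ c(n,k) ≤ n!²/(2 (2n+1)! (n+1)⁴ (k+1)⁴)` and `n!² ≤ (2n)!`, `n!² ≤ (2n+1)!`.
[folklore] -/
private theorem hyp7_bounds (n k : ℕ) :
    0 ≤ ((n.factorial : ℝ) ^ 6 * (k.factorial : ℝ) ^ 4 /
          (2 * ((2 * n + 1).factorial : ℝ) * ((n + k + 1).factorial : ℝ) ^ 4)) ∧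
      ((n.factorial : ℝ) ^ 6 * (k.factorial : ℝ) ^ 4 /
          (2 * ((2 * n + 1).factorial : ℝ) * ((n + k + 1).factorial : ℝ) ^ 4)) ≤
        (n.factorial : ℝ) ^ 2 / (2 * ((2 * n + 1).factorial : ℝ) * ((n : ℝ) + 1) ^ 4 * ((k : ℝ) + 1) ^ 4) ∧
      (2 * (n : ℝ) + 1) * (n.factorial : ℝ) ^ 2 ≤ ((2 * n + 1).factorial : ℝ) ∧
      (n.factorial : ℝ) ^ 2 ≤ ((2 * n + 1).factorial : ℝ) := by
  have hsq : (n.factorial : ℝ) ^ 2 ≤ ((2 * n).factorial : ℝ) := by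
    have h := Nat.le_of_dvd (Nat.factorial_pos _) (Nat.factorial_mul_factorial_dvd_factorial_add n n)
    rw [sq, two_mul]; exact_mod_cast h
  have h21 : ((2 * n + 1).factorial : ℝ) = (2 * (n : ℝ) + 1) * ((2 * n).factorial : ℝ) := by rw [Nat.factorial_succ]; push_cast; ring
  refine ⟨by positivity, ?_, ?_, ?_⟩
  · -- `(n+k+1)! ≥ (n+1) n! (k+1) k!`
    have h := factorial_succ_mul_factorial_succ_le n k
    rw [Nat.factorial_succ, Nat.factorial_succ] at h
    have h' : ((n : ℝ) + 1) * (n.factorial : ℝ) * (((k : ℝ) + 1) * (k.factorial : ℝ)) ≤ ((n + k + 1).factorial : ℝ) := by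
      exact_mod_cast h
    have h4 : (((n : ℝ) + 1) * (n.factorial : ℝ) * (((k : ℝ) + 1) * (k.factorial : ℝ))) ^ 4 ≤
        ((n + k + 1).factorial : ℝ) ^ 4 := pow_le_pow_left₀ (by positivity) h' 4
    rw [div_le_div_iff₀ (by positivity) (by positivity)]
    calc (n.factorial : ℝ) ^ 6 * (k.factorial : ℝ) ^ 4 *
          (2 * ((2 * n + 1).factorial : ℝ) * ((n : ℝ) + 1) ^ 4 * ((k : ℝ) + 1) ^ 4)
        = (n.factorial : ℝ) ^ 2 * (2 * ((2 * n + 1).factorial : ℝ) *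
            (((n : ℝ) + 1) * (n.factorial : ℝ) * (((k : ℝ) + 1) * (k.factorial : ℝ))) ^ 4) := by ring
      _ ≤ (n.factorial : ℝ) ^ 2 * (2 * ((2 * n + 1).factorial : ℝ) * ((n + k + 1).factorial : ℝ) ^ 4) := by
          gcongr
  · rw [h21]; nlinarith [(by positivity : (0 : ℝ) ≤ 2 * (n : ℝ) + 1)]
  · rw [h21]; nlinarith [(by positivity : (0 : ℝ) ≤ 2 * (n : ℝ) + 1), (by positivity : (0 : ℝ) ≤ ((2 * n).factorial : ℝ))]

/-- The analytic hypotheses of the WZ summation for `(F₁, G₁)`: `|F₁(n,k)| ≤ 10/((n+1)³(k+1)²)` and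
`|G₁(n,k)| ≤ 25/((n+1)²(k+1)²)`. [folklore] -/
private theorem ag_pair_facts :
    let F : ℕ → ℕ → ℝ := fun n k =>
      (-1 : ℝ) ^ n * ((n.factorial : ℝ) ^ 6 * (k.factorial : ℝ) ^ 4 /
          (2 * ((2 * n + 1).factorial : ℝ) * ((n + k + 1).factorial : ℝ) ^ 4)) *
        ((2 * (n : ℝ) + 1) * ((n : ℝ) + 2 * k + 2)) *
        (4 * ∑ m ∈ range n, 1 / ((m : ℝ) + 1) ^ 4 + ∑ i ∈ range (n + 1), 1 / ((i : ℝ) + k + 1) ^ 4)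
    let G : ℕ → ℕ → ℝ := fun n k =>
      (-1 : ℝ) ^ n * ((n.factorial : ℝ) ^ 6 * (k.factorial : ℝ) ^ 4 /
          (2 * ((2 * n + 1).factorial : ℝ) * ((n + k + 1).factorial : ℝ) ^ 4)) *
        (5 * ((n : ℝ) + 1) ^ 2 / 2 + 3 * ((n : ℝ) + 1) * k + (k : ℝ) ^ 2) *
        (4 * ∑ m ∈ range n, 1 / ((m : ℝ) + 1) ^ 4 + ∑ i ∈ range (n + 1), 1 / ((i : ℝ) + k + 1) ^ 4)
    (∀ n, Summable (F n)) ∧ (∀ n, Tendsto (G n) atTop (𝓝 0)) ∧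
      Tendsto (fun n => ∑' k, F n k) atTop (𝓝 0) ∧ Summable (fun n => G n 0) := by
  intro F G
  have hS2 : Summable fun k : ℕ => 1 / ((k : ℝ) + 1) ^ 2 := by
    simpa using (summable_nat_add_iff 1).2 (Real.summable_one_div_nat_pow.2 one_lt_two)
  have hFb : ∀ n k : ℕ, ‖F n k‖ ≤ 10 * (1 / ((n : ℝ) + 1) ^ 3) * (1 / ((k : ℝ) + 1) ^ 2) := by
    intro n k
    obtain ⟨hc0, hcb, h2n, -⟩ := hyp7_bounds n k
    obtain ⟨hW0, hW10⟩ := w_bounds n k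
    rw [Real.norm_eq_abs]
    simp only [F]
    set c := ((n.factorial : ℝ) ^ 6 * (k.factorial : ℝ) ^ 4 /
      (2 * ((2 * n + 1).factorial : ℝ) * ((n + k + 1).factorial : ℝ) ^ 4))
    set W := (4 * ∑ m ∈ range n, 1 / ((m : ℝ) + 1) ^ 4 + ∑ i ∈ range (n + 1), 1 / ((i : ℝ) + k + 1) ^ 4)
    have hn : (0 : ℝ) ≤ n := n.cast_nonneg
    have hk : (0 : ℝ) ≤ k := k.cast_nonneg
    rw [abs_mul, abs_mul, abs_mul, abs_pow, abs_neg, abs_one, one_pow, one_mul, abs_of_nonneg hc0,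
      abs_of_nonneg (by positivity : (0 : ℝ) ≤ (2 * (n : ℝ) + 1) * ((n : ℝ) + 2 * k + 2)), abs_of_nonneg hW0]
    have hlin : (n : ℝ) + 2 * k + 2 ≤ 2 * ((n : ℝ) + 1) * ((k : ℝ) + 1) := by nlinarith
    have hf2 : (n.factorial : ℝ) ^ 2 ≤ ((2 * n + 1).factorial : ℝ) / (2 * (n : ℝ) + 1) := by
      rw [le_div_iff₀ (by positivity)]; linarith
    calc c * ((2 * (n : ℝ) + 1) * ((n : ℝ) + 2 * k + 2)) * W
        ≤ ((n.factorial : ℝ) ^ 2 / (2 * ((2 * n + 1).factorial : ℝ) * ((n : ℝ) + 1) ^ 4 * ((k : ℝ) + 1) ^ 4)) *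
            ((2 * (n : ℝ) + 1) * (2 * ((n : ℝ) + 1) * ((k : ℝ) + 1))) * 10 := by gcongr
      _ ≤ (((2 * n + 1).factorial : ℝ) / (2 * (n : ℝ) + 1) /
              (2 * ((2 * n + 1).factorial : ℝ) * ((n : ℝ) + 1) ^ 4 * ((k : ℝ) + 1) ^ 4)) *
            ((2 * (n : ℝ) + 1) * (2 * ((n : ℝ) + 1) * ((k : ℝ) + 1))) * 10 := by gcongr
      _ = 10 * (1 / ((n : ℝ) + 1) ^ 3) * (1 / ((k : ℝ) + 1) ^ 3) := by
          field_simp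
      _ ≤ 10 * (1 / ((n : ℝ) + 1) ^ 3) * (1 / ((k : ℝ) + 1) ^ 2) := by
          apply mul_le_mul_of_nonneg_left _ (by positivity)
          exact one_div_le_one_div_of_le (by positivity) (pow_le_pow_right₀ (by linarith) (by norm_num))
  have hGb : ∀ n k : ℕ, ‖G n k‖ ≤ 25 * (1 / ((n : ℝ) + 1) ^ 2) * (1 / ((k : ℝ) + 1) ^ 2) := by
    intro n k
    obtain ⟨hc0, hcb, -, hf1⟩ := hyp7_bounds n k
    obtain ⟨hW0, hW10⟩ := w_bounds n k
    rw [Real.norm_eq_abs]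
    simp only [G]
    set c := ((n.factorial : ℝ) ^ 6 * (k.factorial : ℝ) ^ 4 /
      (2 * ((2 * n + 1).factorial : ℝ) * ((n + k + 1).factorial : ℝ) ^ 4))
    set W := (4 * ∑ m ∈ range n, 1 / ((m : ℝ) + 1) ^ 4 + ∑ i ∈ range (n + 1), 1 / ((i : ℝ) + k + 1) ^ 4)
    have hn : (0 : ℝ) ≤ n := n.cast_nonneg
    have hk : (0 : ℝ) ≤ k := k.cast_nonneg
    have hq0 : (0 : ℝ) ≤ 5 * ((n : ℝ) + 1) ^ 2 / 2 + 3 * ((n : ℝ) + 1) * k + (k : ℝ) ^ 2 := by positivity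
    rw [abs_mul, abs_mul, abs_mul, abs_pow, abs_neg, abs_one, one_pow, one_mul, abs_of_nonneg hc0,
      abs_of_nonneg hq0, abs_of_nonneg hW0]
    have hquad : 5 * ((n : ℝ) + 1) ^ 2 / 2 + 3 * ((n : ℝ) + 1) * k + (k : ℝ) ^ 2 ≤
        5 * ((n : ℝ) + 1) ^ 2 * ((k : ℝ) + 1) ^ 2 := by nlinarith [mul_nonneg hn hk, mul_nonneg (mul_nonneg hn hn) hk]
    calc c * (5 * ((n : ℝ) + 1) ^ 2 / 2 + 3 * ((n : ℝ) + 1) * k + (k : ℝ) ^ 2) * W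
        ≤ ((n.factorial : ℝ) ^ 2 / (2 * ((2 * n + 1).factorial : ℝ) * ((n : ℝ) + 1) ^ 4 * ((k : ℝ) + 1) ^ 4)) *
            (5 * ((n : ℝ) + 1) ^ 2 * ((k : ℝ) + 1) ^ 2) * 10 := by gcongr
      _ ≤ (((2 * n + 1).factorial : ℝ) / (2 * ((2 * n + 1).factorial : ℝ) * ((n : ℝ) + 1) ^ 4 * ((k : ℝ) + 1) ^ 4)) *
            (5 * ((n : ℝ) + 1) ^ 2 * ((k : ℝ) + 1) ^ 2) * 10 := by gcongr
      _ = 25 * (1 / ((n : ℝ) + 1) ^ 2) * (1 / ((k : ℝ) + 1) ^ 2) := by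
          field_simp
          ring
  refine ⟨fun n => Summable.of_norm_bounded (hS2.mul_left _) (hFb n), fun n => ?_, ?_, ?_⟩
  · -- `G(n,k) → 0`
    refine squeeze_zero_norm (hGb n) ?_
    have h := (hS2.tendsto_atTop_zero).const_mul (25 * (1 / ((n : ℝ) + 1) ^ 2))
    rw [mul_zero] at h
    exact h
  · -- `Σ_k F(n,k) → 0`
    have hle : ∀ n : ℕ, ‖∑' k, F n k‖ ≤ 10 * (1 / ((n : ℝ) + 1) ^ 3) * ∑' k : ℕ, 1 / ((k : ℝ) + 1) ^ 2 :=
      fun n => tsum_of_norm_bounded (hS2.hasSum.mul_left _) (hFb n)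
    refine squeeze_zero_norm hle ?_
    have h3 : Tendsto (fun n : ℕ => 1 / ((n : ℝ) + 1) ^ 3) atTop (𝓝 0) :=
      tendsto_const_nhds.div_atTop ((tendsto_pow_atTop (by norm_num : (3 : ℕ) ≠ 0)).comp
        (tendsto_atTop_add_const_right _ _ tendsto_natCast_atTop_atTop))
    have h := (h3.const_mul 10).mul_const (∑' k : ℕ, 1 / ((k : ℝ) + 1) ^ 2)
    rw [mul_zero, zero_mul] at h
    exact h
  · -- `G(·,0)` summable
    refine Summable.of_norm_bounded (hS2.mul_left 25) fun n => (hGb n 0).trans (le_of_eq ?_)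
    simp

/-- `C(2n+2, n+1) = (2n+2)(2n+1)!/((n+1)² n!²)` in `ℝ` (as in `KoecherZetaFiveProofs.lean`). [folklore] -/
private theorem centralBinom_succ_eq' (n : ℕ) :
    (((n + 1).centralBinom : ℕ) : ℝ) =
      (2 * (n : ℝ) + 2) * ((2 * n + 1).factorial : ℝ) / (((n : ℝ) + 1) ^ 2 * (n.factorial : ℝ) ^ 2) := by
  have h := Nat.choose_mul_factorial_mul_factorial (show n + 1 ≤ 2 * (n + 1) by omega)
  rw [show 2 * (n + 1) - (n + 1) = n + 1 by omega, ← Nat.centralBinom_eq_two_mul_choose,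
    show 2 * (n + 1) = (2 * n + 1) + 1 by ring, Nat.factorial_succ (2 * n + 1), Nat.factorial_succ n] at h
  have h' : (((n + 1).centralBinom : ℕ) : ℝ) * (((n : ℝ) + 1) * (n.factorial : ℝ)) * (((n : ℝ) + 1) * (n.factorial : ℝ)) =
      (2 * (n : ℝ) + 1 + 1) * ((2 * n + 1).factorial : ℝ) := by exact_mod_cast h
  rw [eq_div_iff (by positivity)]
  linear_combination h'

/-- **The Apéry-like formula for `ζ(7)`** (discharge of the named fact `zeta_seven_apery_like`):
`ζ(7) = (5/2) Σ_{k≥1} (−1)^{k+1}/(k⁷ C(2k,k)) + (25/2) Σ_{k≥1} ((−1)^{k+1}/(k³ C(2k,k))) Σ_{j<k} j⁻⁴`, by the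
`b⁴`-coefficient of the Hessami Pilehrood Markov–WZ pair for the Almkvist–Granville generating function.
[cite: BorweinBaileyGirgensohn2004, §3.2.2 (3.19) p. 96] [cite: Rivoal2004, p. 504 (display after (1–3))]
[cite: AlmkvistGranville1999, Theorem (the generating function of ζ(4s+3))]
[cite: HessamiPilehrood2008MarkovWZ, Theorem 1 and §2 (the Markov–WZ pair)] -/
theorem zeta_seven_apery_like_holds : zeta_seven_apery_like := by
  obtain ⟨hFs, hGt, hFt, hG0⟩ := ag_pair_facts
  have key := wz_tsum_eq' (fun n k => ag_wz n k) hFs hGt hFt hG0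
  have hS2 : Summable fun k : ℕ => 1 / ((k : ℝ) + 1) ^ 2 := by
    simpa using (summable_nat_add_iff 1).2 (Real.summable_one_div_nat_pow.2 one_lt_two)
  have hS7 : Summable fun n : ℕ => 1 / (n : ℝ) ^ 7 := Real.summable_one_div_nat_pow.2 (by norm_num)
  unfold zeta_seven_apery_like
  rw [Literature.NumberTheory.Transcendental.zetaValue, hS7.tsum_eq_zero_add]
  convert key using 1
  · -- the left-hand side: `F₁(0,k) = (k+1)⁻⁷`
    rw [Nat.cast_zero, zero_pow (by norm_num), div_zero, zero_add]
    refine tsum_congr fun k => ?_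
    rw [show 2 * 0 + 1 = 1 by ring, show 0 + k + 1 = k + 1 by ring, Nat.factorial_succ k, Nat.factorial_one,
      Nat.factorial_zero]
    have hk : (k.factorial : ℝ) ≠ 0 := by positivity
    simp only [sum_range_zero, sum_range_one, pow_zero, one_mul, one_pow, Nat.cast_zero, zero_add, mul_zero,
      Nat.cast_one]
    push_cast
    field_simp
  · -- the right-hand side: `G₁(n,0) = (5/2)(−1)ⁿ/((n+1)⁷C) + (25/2)(−1)ⁿ U_n/((n+1)³C)`
    have hC1 : ∀ n : ℕ, (1 : ℝ) ≤ (((n + 1).centralBinom : ℕ) : ℝ) := fun n => by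
      exact_mod_cast Nat.succ_le_of_lt (Nat.centralBinom_pos (n + 1))
    have hA0 : Summable fun k : ℕ => (-1 : ℝ) ^ (k + 2) / (((k + 1 : ℕ) : ℝ) ^ 7 * ((k + 1).centralBinom : ℝ)) := by
      refine Summable.of_norm_bounded hS2 fun k => ?_
      have hpos : (0 : ℝ) < (((k + 1 : ℕ) : ℝ)) ^ 7 * (((k + 1).centralBinom : ℕ) : ℝ) :=
        mul_pos (by positivity) (one_pos.trans_le (hC1 k))
      rw [norm_div, norm_pow, norm_neg, norm_one, one_pow, Real.norm_of_nonneg hpos.le]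
      push_cast
      apply div_le_div_of_nonneg_left zero_le_one (by positivity)
      have hk : (1 : ℝ) ≤ (k : ℝ) + 1 := by linarith [(k.cast_nonneg : (0 : ℝ) ≤ k)]
      calc ((k : ℝ) + 1) ^ 2 ≤ ((k : ℝ) + 1) ^ 7 := pow_le_pow_right₀ hk (by norm_num)
        _ ≤ ((k : ℝ) + 1) ^ 7 * (((k + 1).centralBinom : ℕ) : ℝ) := le_mul_of_one_le_right (by positivity) (hC1 k)
    have hB0 : Summable fun k : ℕ => (-1 : ℝ) ^ (k + 2) / (((k + 1 : ℕ) : ℝ) ^ 3 * ((k + 1).centralBinom : ℝ)) *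
        ∑ j ∈ Ico 1 (k + 1), 1 / (j : ℝ) ^ 4 := by
      refine Summable.of_norm_bounded (hS2.mul_left 2) fun k => ?_
      have hHk : 0 ≤ ∑ j ∈ Ico 1 (k + 1), 1 / (j : ℝ) ^ 4 := sum_nonneg fun j _ => by positivity
      have hHk2 : ∑ j ∈ Ico 1 (k + 1), 1 / (j : ℝ) ^ 4 ≤ 2 := by
        rw [Finset.sum_Ico_eq_sum_range, Nat.add_sub_cancel]
        refine le_trans (sum_le_sum fun m _ => ?_) (harm_two_le k)
        push_cast
        rw [show (1 : ℝ) + m = m + 1 by ring]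
        apply div_le_div_of_nonneg_left zero_le_one (by positivity)
        have : (1 : ℝ) ≤ (m : ℝ) + 1 := by linarith [(m.cast_nonneg : (0 : ℝ) ≤ m)]
        exact pow_le_pow_right₀ this (by norm_num)
      have hpos : (0 : ℝ) < (((k + 1 : ℕ) : ℝ)) ^ 3 * (((k + 1).centralBinom : ℕ) : ℝ) :=
        mul_pos (by positivity) (one_pos.trans_le (hC1 k))
      rw [norm_mul, norm_div, norm_pow, norm_neg, norm_one, one_pow, Real.norm_of_nonneg hpos.le,
        Real.norm_of_nonneg hHk]
      push_cast
      have hk : (1 : ℝ) ≤ (k : ℝ) + 1 := by linarith [(k.cast_nonneg : (0 : ℝ) ≤ k)]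
      have hden : ((k : ℝ) + 1) ^ 2 ≤ ((k : ℝ) + 1) ^ 3 * (((k + 1).centralBinom : ℕ) : ℝ) :=
        (pow_le_pow_right₀ hk (by norm_num)).trans (le_mul_of_one_le_right (by positivity) (hC1 k))
      calc 1 / (((k : ℝ) + 1) ^ 3 * (((k + 1).centralBinom : ℕ) : ℝ)) * ∑ j ∈ Ico 1 (k + 1), 1 / (j : ℝ) ^ 4
          ≤ 1 / ((k : ℝ) + 1) ^ 2 * 2 :=
            mul_le_mul (div_le_div_of_nonneg_left zero_le_one (by positivity) hden) hHk2 hHk (by positivity)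
        _ = 2 * (1 / ((k : ℝ) + 1) ^ 2) := by ring
    rw [← tsum_mul_left, ← tsum_mul_left, ← (hA0.mul_left (5 / 2)).tsum_add (hB0.mul_left (25 / 2))]
    refine tsum_congr fun n => ?_
    have es : ((-1 : ℝ)) ^ (n + 2) = (-1) ^ n := by rw [pow_add]; norm_num
    have eH : ∑ j ∈ Ico 1 (n + 1), 1 / (j : ℝ) ^ 4 = ∑ m ∈ range n, 1 / ((m : ℝ) + 1) ^ 4 := by
      rw [Finset.sum_Ico_eq_sum_range, Nat.add_sub_cancel]
      exact sum_congr rfl fun m _ => by push_cast; ring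
    have eT : ∑ i ∈ range (n + 1), 1 / ((i : ℝ) + ((0 : ℕ) : ℝ) + 1) ^ 4 =
        ∑ m ∈ range n, 1 / ((m : ℝ) + 1) ^ 4 + 1 / ((n : ℝ) + 1) ^ 4 := by
      rw [sum_range_succ]; simp
    rw [es, eH, eT, centralBinom_succ_eq' n]
    simp only [add_zero, Nat.cast_zero, Nat.factorial_zero, Nat.cast_one, mul_zero,
      zero_pow two_ne_zero, one_pow, mul_one]
    set U := ∑ m ∈ range n, 1 / ((m : ℝ) + 1) ^ 4
    set s := ((-1 : ℝ)) ^ n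
    have e1 : ((n + 0 + 1).factorial : ℝ) = ((n : ℝ) + 1) * (n.factorial : ℝ) := by
      rw [add_zero, Nat.factorial_succ]; push_cast; ring
    rw [e1]
    push_cast
    have h1 : (n.factorial : ℝ) ≠ 0 := by positivity
    have h2 : ((2 * n + 1).factorial : ℝ) ≠ 0 := by positivity
    field_simp
    ring

end Literature.NumberTheory.ZetaValues
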